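import Summits.QuantumFields.YangMills.Theorems.SwapVirialDeficitZeroModeThreeLower
import HarnessLib

/-!
# The `k = 3` zero-mode block is REGULAR, IV-b: the `β`-free UPPER kernel, `A₃ ≤ L₃`, and the pointwise gap `k_∞ ≤ k_β + d_β`
# (free-hands support of crux ⟨stmt-QuantumFields-24197⟩ `SwapVirialDeficit.SwapGluedStiffness`, LINE «sharp-sigma»; companion of files I–IV-a
# ✓`SwapVirialDeficitZeroModeThree{Scaling,Bound,NoLog,Lower}`)

* §13 the `β`-free UPPER kernel `k_∞(r,y) = 𝟙{|y_μ2| ≤ 1 ∀μ}·exp(−cr − plSum − r²(y₀₂²+y₁₂²)/2)` with `G⁺₃(β,re₃)(Λ_r y) ≤ e^{−r²/2}k_∞(r,y)`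
  (`Λ_r = diag(1/(r√β),1/(r√β),r)` on both columns), hence ★★ `β²Z₃(β) ≤ L₃ := 3∫ e^{−‖a‖²/2}‖a‖⁻²∫k_∞(‖a‖,·)` for all `β > 0` and ★★ `A₃ ≤ L₃`;
* §14 ★ the POINTWISE GAP `k_∞ ≤ k_β + d_β`, `d_β(r,y) = 𝟙_{slab}e^{−plSum}·[(plSq y₀·plSq y₁/r⁴ + plSum/(2r²))/β + Σ_μ 𝟙{1 − plSq(y_μ)/(r⁴β) ≤ y_μ2²}]`
  (`1 − e^{−x} ≤ x`, planar Cauchy–Schwarz `(y₀₀y₁₁−y₀₁y₁₀)² ≤ plSq y₀·plSq y₁`) — files V–VI integrate `d_β` (`≲ (r⁻⁴+r⁻²)/β`) and split radially at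
  `ρ = β^{-1/4}` to get `|β²Z₃(β) − A₃| ≤ K·β^{-1/4}`, the `t^{1/4}` correction of the LINE card «sharp-sigma».

HONEST LABEL: finite-dimensional Laplace analysis (plan-level zero-mode rung of a DRAFT line); not the fixed-`L` sharp law, not ⟨24197⟩/⟨24194⟩, no rung /
summit statement; the Yang–Mills mass gap is NOT proved; no summit is proved by a line.  Width seat ym-line-sfw-p2-w3 g62 (cell ym-idea-1, free hands),
`--supports stmt-QuantumFields-24197`.  Standard axioms, 0 `sorry`.  References: [cite: tHooft1979]; [cite: Vanbaal2001]; [folklore].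
-/

set_option autoImplicit false

noncomputable section

namespace Summit.QuantumFields.YangMills.Theorems.ToronValleyVolume.ZeroMode

open MeasureTheory Real Finset Set Filter
open scoped ENNReal Topology
open Summit.QuantumFields.YangMills.Cruxes.ToronTubeVolumeLaw.Birth

/-! ## §13 The `β`-free upper kernel `k_∞` and `A₃ ≤ L₃` -/

/-- The real exponential part of the upper kernel. -/
def kupR (r : ℝ) (y : Fin 2 → EuclideanSpace ℝ (Fin 3)) : ℝ :=
  Real.exp (-(cr (y 0) (y 1) + (plSq (y 0) + plSq (y 1)) + r ^ 2 * ((y 0 2) ^ 2 + (y 1 2) ^ 2) / 2))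

/-- Auxiliary: `continuous_kupR`. [folklore] -/
theorem continuous_kupR (r : ℝ) : Continuous (kupR r) := by unfold kupR cr plSq; fun_prop

/-- THE `β`-FREE UPPER KERNEL `k_∞(r,y) = 𝟙_{slab2}(y)·kupR r y`. -/
def kup (r : ℝ) (y : Fin 2 → EuclideanSpace ℝ (Fin 3)) : ℝ≥0∞ := slab2.indicator (fun y => ENNReal.ofReal (kupR r y)) y

/-- Auxiliary: `measurable_kup`. [folklore] -/
theorem measurable_kup (r : ℝ) : Measurable (kup r) :=
  (ENNReal.measurable_ofReal.comp (continuous_kupR r).measurable).indicator measurableSet_slab2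

/-- `k_β ≤ k_∞` pointwise (`r, β > 0`). [folklore] -/
theorem klow_le_kup {β r : ℝ} (hβ : 0 < β) (hr : 0 < r) (y : Fin 2 → EuclideanSpace ℝ (Fin 3)) : klow β r y ≤ kup r y := by
  unfold klow kup
  by_cases hy : y ∈ boxResc β r
  · have hy' : y ∈ slab2 := by
      intro μ
      have h1 := hy μ
      have h2 : 0 ≤ plSq (y μ) / (r ^ 4 * β) := div_nonneg (plSq_nonneg _) (by positivity)
      rw [abs_le]; constructor <;> nlinarith
    rw [indicator_of_mem hy, indicator_of_mem hy']
    refine ENNReal.ofReal_le_ofReal (Real.exp_le_exp.2 ?_)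
    have h1 : 0 ≤ (y 0 0 * y 1 1 - y 0 1 * y 1 0) ^ 2 / (r ^ 4 * β) := div_nonneg (sq_nonneg _) (by positivity)
    have h2 : 0 ≤ (plSq (y 0) + plSq (y 1)) / (2 * r ^ 2 * β) :=
      div_nonneg (add_nonneg (plSq_nonneg _) (plSq_nonneg _)) (by positivity)
    linarith
  · rw [indicator_of_notMem hy]; exact zero_le

/-- POINTWISE upper box bound with the full kernel: `G⁺₃(β, re₃)(Λ_r y) ≤ e^{−r²/2}·k_∞(r,y)` (`r, β > 0`). [folklore] -/
theorem G3_Lam2_le_kup {β r : ℝ} (hβ : 0 < β) (hr : 0 < r) (y : Fin 2 → EuclideanSpace ℝ (Fin 3)) :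
    G3 β (r • e3) (Lam2 (r * Real.sqrt β)⁻¹ r y) ≤ ENNReal.ofReal (Real.exp (-r ^ 2 / 2)) * kup r y := by
  unfold G3 kup
  have hs2 : ((r * Real.sqrt β)⁻¹) ^ 2 = (r ^ 2 * β)⁻¹ := by rw [inv_pow, mul_pow, Real.sq_sqrt hβ.le]
  have hre3 : ‖r • e3‖ = r := by rw [norm_smul, norm_e3, mul_one, Real.norm_eq_abs, abs_of_pos hr]
  by_cases hx : Lam2 (r * Real.sqrt β)⁻¹ r y ∈ boxLe2 (r • e3)
  · have hy : y ∈ slab2 := by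
      intro μ
      have h1 : ‖(Lam2 (r * Real.sqrt β)⁻¹ r y) μ‖ ≤ ‖r • e3‖ := hx μ
      rw [hre3] at h1
      have h2 : |(Lam2 (r * Real.sqrt β)⁻¹ r y) μ 2| ≤ r := (abs_coord_le_norm _ 2).trans h1
      rw [Lam2_apply, diag3_apply_two, abs_mul, abs_of_pos hr] at h2
      exact le_of_mul_le_mul_left (by linarith) hr
    rw [indicator_of_mem hx, indicator_of_mem hy, ← ENNReal.ofReal_mul (Real.exp_pos _).le]
    refine ENNReal.ofReal_le_ofReal ?_
    unfold kupR
    rw [← Real.exp_add, zmI_three_snoc, sum_two_pd_smul_e3, pd_eq_coord, Fin.sum_univ_two, hre3]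
    rw [normSq_eq_plSq_add ((Lam2 (r * Real.sqrt β)⁻¹ r y) 0), normSq_eq_plSq_add ((Lam2 (r * Real.sqrt β)⁻¹ r y) 1)]
    refine Real.exp_le_exp.2 ?_
    simp only [Lam2_apply, cr_diag3, plSq_diag3, diag3_apply_zero, diag3_apply_one, diag3_apply_two]
    rw [hs2]
    have hrβ : r ^ 2 * β ≠ 0 := by positivity
    have e1 : β * ((r ^ 2 * β)⁻¹ * r ^ 2 * cr (y 0) (y 1)) = cr (y 0) (y 1) := by field_simp
    have e2 : β * (r ^ 2 * ((r ^ 2 * β)⁻¹ * plSq (y 0) + (r ^ 2 * β)⁻¹ * plSq (y 1))) = plSq (y 0) + plSq (y 1) := by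
      field_simp
    have hD : 0 ≤ β * ((r * Real.sqrt β)⁻¹ * y 0 0 * ((r * Real.sqrt β)⁻¹ * y 1 1) -
        (r * Real.sqrt β)⁻¹ * y 0 1 * ((r * Real.sqrt β)⁻¹ * y 1 0)) ^ 2 := by positivity
    have hP : 0 ≤ (r ^ 2 * β)⁻¹ * plSq (y 0) + (r ^ 2 * β)⁻¹ * plSq (y 1) := by
      have := plSq_nonneg (y 0); have := plSq_nonneg (y 1); positivity
    nlinarith [e1, e2, hD, hP]
  · rw [indicator_of_notMem hx]; exact zero_le

/-- THE UPPER CONSTANT `L₃ = 3·∫ e^{−‖a‖²/2}‖a‖⁻²·(∫k_∞(‖a‖,·)) da`. -/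
def L3 : ℝ≥0∞ := 3 * ∫⁻ a : EuclideanSpace ℝ (Fin 3), ENNReal.ofReal (Real.exp (-‖a‖ ^ 2 / 2) / ‖a‖ ^ 2) * ∫⁻ y, kup ‖a‖ y

/-- ★★ **UPPER REPRESENTATION**: `β²·Z₃(β) ≤ L₃` for every `β > 0`. [folklore] -/
theorem ofReal_sq_mul_zeroModeZ_three_le_L3 {β : ℝ} (hβ : 0 < β) : ENNReal.ofReal (β ^ 2 * zeroModeZ 3 β) ≤ L3 := by
  have hae : ∀ᵐ a : EuclideanSpace ℝ (Fin 3) ∂volume, a ≠ 0 := ae_iff.2 (by simp)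
  have hpt : ∀ᵐ a : EuclideanSpace ℝ (Fin 3) ∂volume,
      ENNReal.ofReal (β ^ 2) * PhiP3 β (‖a‖ • e3) ≤
        ENNReal.ofReal (Real.exp (-‖a‖ ^ 2 / 2) / ‖a‖ ^ 2) * ∫⁻ y, kup ‖a‖ y := by
    filter_upwards [hae] with a ha
    have hr : 0 < ‖a‖ := norm_pos_iff.2 ha
    have hs : (‖a‖ * Real.sqrt β)⁻¹ ≠ 0 := inv_ne_zero (mul_pos hr (Real.sqrt_pos.2 hβ)).ne'
    have h := lintegral_comp_Lam2 hs hr.ne' _ (measurable_G3 β (‖a‖ • e3))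
    have hdet : |((‖a‖ * Real.sqrt β)⁻¹ * (‖a‖ * Real.sqrt β)⁻¹ * ‖a‖) ^ 2|⁻¹ = (‖a‖ * β) ^ 2 := by
      rw [← mul_inv, show ‖a‖ * Real.sqrt β * (‖a‖ * Real.sqrt β) = ‖a‖ * ‖a‖ * (Real.sqrt β * Real.sqrt β) by ring,
        Real.mul_self_sqrt hβ.le, abs_of_nonneg (sq_nonneg _), ← inv_pow, mul_inv, inv_inv]
      congr 1; field_simp
    have hcol : ENNReal.ofReal ((‖a‖ * β) ^ 2) * PhiP3 β (‖a‖ • e3) ≤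
        ENNReal.ofReal (Real.exp (-‖a‖ ^ 2 / 2)) * ∫⁻ y, kup ‖a‖ y := by
      unfold PhiP3
      rw [← hdet, ← h, ← lintegral_const_mul _ (measurable_kup ‖a‖)]
      exact lintegral_mono fun y => G3_Lam2_le_kup hβ hr y
    have hr2 : ENNReal.ofReal (‖a‖ ^ 2) ≠ 0 := (ENNReal.ofReal_pos.2 (by positivity)).ne'
    have hr2' : ENNReal.ofReal (‖a‖ ^ 2) ≠ ⊤ := ENNReal.ofReal_ne_top
    have h2 : ENNReal.ofReal (β ^ 2) * PhiP3 β (‖a‖ • e3) =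
        (ENNReal.ofReal (‖a‖ ^ 2))⁻¹ * (ENNReal.ofReal ((‖a‖ * β) ^ 2) * PhiP3 β (‖a‖ • e3)) := by
      rw [mul_pow, ENNReal.ofReal_mul (sq_nonneg _), ← mul_assoc, ← mul_assoc, ENNReal.inv_mul_cancel hr2 hr2', one_mul]
    rw [h2]
    calc (ENNReal.ofReal (‖a‖ ^ 2))⁻¹ * (ENNReal.ofReal ((‖a‖ * β) ^ 2) * PhiP3 β (‖a‖ • e3))
        ≤ (ENNReal.ofReal (‖a‖ ^ 2))⁻¹ * (ENNReal.ofReal (Real.exp (-‖a‖ ^ 2 / 2)) * ∫⁻ y, kup ‖a‖ y) := by gcongr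
      _ = ENNReal.ofReal (Real.exp (-‖a‖ ^ 2 / 2) / ‖a‖ ^ 2) * ∫⁻ y, kup ‖a‖ y := by
          rw [ENNReal.ofReal_div_of_pos (by positivity), ENNReal.div_eq_inv_mul, mul_assoc]
  have hF3 : ∫⁻ c, ENNReal.ofReal (zmI 3 β c) ≤ 3 * ∫⁻ a, PhiP3 β a := lintegral_F3_le_three_PhiP3 β
  have hax : (∫⁻ a, PhiP3 β a) = ∫⁻ a : EuclideanSpace ℝ (Fin 3), PhiP3 β (‖a‖ • e3) :=
    lintegral_congr fun a => PhiP3_eq_axis β a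
  calc ENNReal.ofReal (β ^ 2 * zeroModeZ 3 β)
      = ENNReal.ofReal (β ^ 2) * ∫⁻ c, ENNReal.ofReal (zmI 3 β c) := by
        rw [ENNReal.ofReal_mul (sq_nonneg _), ofReal_zeroModeZ 3 hβ.le]
    _ ≤ ENNReal.ofReal (β ^ 2) * (3 * ∫⁻ a, PhiP3 β a) := by gcongr
    _ = 3 * ∫⁻ a, ENNReal.ofReal (β ^ 2) * PhiP3 β (‖a‖ • e3) := by
        rw [lintegral_const_mul' _ _ ENNReal.ofReal_ne_top, hax]; ring
    _ ≤ L3 := by unfold L3; gcongr 3 * ?_; exact lintegral_mono_ae hpt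

/-- ★★ `A₃ ≤ L₃`: the limit constant is dominated by the `β`-free upper kernel. [folklore] -/
theorem ofReal_A3_le_L3 : ENNReal.ofReal A3 ≤ L3 := by
  have ht : Tendsto (fun β : ℝ => ENNReal.ofReal (β ^ 2 * zeroModeZ 3 β)) atTop (𝓝 (ENNReal.ofReal A3)) :=
    (ENNReal.continuous_ofReal.tendsto _).comp tendsto_zeroModeZ_three
  exact le_of_tendsto ht (by filter_upwards [eventually_gt_atTop (0 : ℝ)] with β hβ using
    ofReal_sq_mul_zeroModeZ_three_le_L3 hβ)

/-! ## §14 The pointwise gap `k_∞ ≤ k_β + d_β` -/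

/-- The real gap majorant `e^{−plSum}·[(plSq y₀·plSq y₁/r⁴ + plSum/(2r²))/β + Σ_μ 𝟙{1 − plSq(y_μ)/(r⁴β) ≤ y_μ2²}]`. -/
def dgapR (β r : ℝ) (y : Fin 2 → EuclideanSpace ℝ (Fin 3)) : ℝ :=
  Real.exp (-(plSq (y 0) + plSq (y 1))) *
    ((plSq (y 0) * plSq (y 1) / r ^ 4 + (plSq (y 0) + plSq (y 1)) / (2 * r ^ 2)) / β
      + ∑ μ : Fin 2, if 1 - plSq (y μ) / (r ^ 4 * β) ≤ (y μ 2) ^ 2 then (1 : ℝ) else 0)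

/-- Auxiliary: `dgapR_nonneg`. [folklore] -/
theorem dgapR_nonneg {β r : ℝ} (hβ : 0 < β) (y : Fin 2 → EuclideanSpace ℝ (Fin 3)) : 0 ≤ dgapR β r y := by
  unfold dgapR
  have h0 := plSq_nonneg (y 0); have h1 := plSq_nonneg (y 1)
  refine mul_nonneg (Real.exp_pos _).le (add_nonneg (by positivity) (Finset.sum_nonneg fun μ _ => ?_))
  split_ifs <;> norm_num

/-- THE GAP MAJORANT `d_β(r,y) = 𝟙_{slab2}(y)·dgapR β r y`. -/
def dgap (β r : ℝ) (y : Fin 2 → EuclideanSpace ℝ (Fin 3)) : ℝ≥0∞ := slab2.indicator (fun y => ENNReal.ofReal (dgapR β r y)) y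

/-- `1 − e^{−x} ≤ x`, in the form `e^{−E} − e^{−E−x} ≤ e^{−E}·x` (all real `x`). [folklore] -/
theorem exp_neg_sub_exp_neg_add_le (E x : ℝ) : Real.exp (-E) - Real.exp (-(E + x)) ≤ Real.exp (-E) * x := by
  rw [show -(E + x) = -E + -x by ring, Real.exp_add]
  have h1 : 1 - x ≤ Real.exp (-x) := by linarith [Real.add_one_le_exp (-x)]
  nlinarith [Real.exp_pos (-E), h1]

/-- ★ **POINTWISE GAP**: `k_∞(r,y) ≤ k_β(r,y) + d_β(r,y)` (`r, β > 0`). [folklore] -/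
theorem kup_le_klow_add_dgap {β r : ℝ} (hβ : 0 < β) (hr : 0 < r) (y : Fin 2 → EuclideanSpace ℝ (Fin 3)) :
    kup r y ≤ klow β r y + dgap β r y := by
  unfold kup klow dgap
  by_cases hy : y ∈ slab2
  swap
  · rw [indicator_of_notMem hy]; exact zero_le
  rw [indicator_of_mem hy, indicator_of_mem hy]
  have hP0 := plSq_nonneg (y 0); have hP1 := plSq_nonneg (y 1)
  have hr4β : 0 < r ^ 4 * β := by positivity
  -- `k_∞ ≤ e^{−plSum}` always
  have hkup_le : kupR r y ≤ Real.exp (-(plSq (y 0) + plSq (y 1))) := by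
    unfold kupR; refine Real.exp_le_exp.2 ?_
    have := cr_nonneg (y 0) (y 1); nlinarith [sq_nonneg (y 0 2), sq_nonneg (y 1 2), sq_nonneg r]
  by_cases hb : y ∈ boxResc β r
  · -- inside the rescaled box: `1 − e^{−E₁/β} ≤ E₁/β`, planar Cauchy–Schwarz for the Gram square
    have hk0 : 0 ≤ klowR β r y := (Real.exp_pos _).le
    rw [indicator_of_mem hb, ← ENNReal.ofReal_add hk0 (dgapR_nonneg hβ y)]
    refine ENNReal.ofReal_le_ofReal ?_
    have hE1 : 0 ≤ (y 0 0 * y 1 1 - y 0 1 * y 1 0) ^ 2 / (r ^ 4 * β) + (plSq (y 0) + plSq (y 1)) / (2 * r ^ 2 * β) := by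
      positivity
    have hsplit : klowR β r y = Real.exp (-((cr (y 0) (y 1) + (plSq (y 0) + plSq (y 1)) +
        r ^ 2 * ((y 0 2) ^ 2 + (y 1 2) ^ 2) / 2) + ((y 0 0 * y 1 1 - y 0 1 * y 1 0) ^ 2 / (r ^ 4 * β) +
        (plSq (y 0) + plSq (y 1)) / (2 * r ^ 2 * β)))) := by
      unfold klowR; congr 1; ring
    have hgap := exp_neg_sub_exp_neg_add_le (cr (y 0) (y 1) + (plSq (y 0) + plSq (y 1)) +
        r ^ 2 * ((y 0 2) ^ 2 + (y 1 2) ^ 2) / 2) ((y 0 0 * y 1 1 - y 0 1 * y 1 0) ^ 2 / (r ^ 4 * β) +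
        (plSq (y 0) + plSq (y 1)) / (2 * r ^ 2 * β))
    rw [← hsplit] at hgap
    change kupR r y ≤ klowR β r y + dgapR β r y
    have hkupR : kupR r y = Real.exp (-(cr (y 0) (y 1) + (plSq (y 0) + plSq (y 1)) +
        r ^ 2 * ((y 0 2) ^ 2 + (y 1 2) ^ 2) / 2)) := rfl
    -- the Gram square is at most `plSq y₀ · plSq y₁`
    have hCS : (y 0 0 * y 1 1 - y 0 1 * y 1 0) ^ 2 ≤ plSq (y 0) * plSq (y 1) := by
      unfold plSq; nlinarith [sq_nonneg (y 0 0 * y 1 0 + y 0 1 * y 1 1)]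
    have hE1le : (y 0 0 * y 1 1 - y 0 1 * y 1 0) ^ 2 / (r ^ 4 * β) + (plSq (y 0) + plSq (y 1)) / (2 * r ^ 2 * β)
        ≤ (plSq (y 0) * plSq (y 1) / r ^ 4 + (plSq (y 0) + plSq (y 1)) / (2 * r ^ 2)) / β := by
      calc (y 0 0 * y 1 1 - y 0 1 * y 1 0) ^ 2 / (r ^ 4 * β) + (plSq (y 0) + plSq (y 1)) / (2 * r ^ 2 * β)
          ≤ plSq (y 0) * plSq (y 1) / (r ^ 4 * β) + (plSq (y 0) + plSq (y 1)) / (2 * r ^ 2 * β) := by gcongr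
        _ = (plSq (y 0) * plSq (y 1) / r ^ 4 + (plSq (y 0) + plSq (y 1)) / (2 * r ^ 2)) / β := by
          have hr0 : r ≠ 0 := hr.ne'
          have hβ0 : β ≠ 0 := hβ.ne'
          field_simp
    have hind : 0 ≤ ∑ μ : Fin 2, (if 1 - plSq (y μ) / (r ^ 4 * β) ≤ (y μ 2) ^ 2 then (1 : ℝ) else 0) :=
      Finset.sum_nonneg fun μ _ => by split_ifs <;> norm_num
    unfold dgapR
    rw [hkupR] at hkup_le ⊢
    nlinarith [hgap, hkup_le, hE1le, hind, Real.exp_pos (-(plSq (y 0) + plSq (y 1))),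
      mul_le_mul_of_nonneg_left hE1le (Real.exp_pos (-(cr (y 0) (y 1) + (plSq (y 0) + plSq (y 1)) +
        r ^ 2 * ((y 0 2) ^ 2 + (y 1 2) ^ 2) / 2))).le]
  · -- outside the rescaled box but inside the slab: some column has `1 − plSq/(r⁴β) ≤ z²`, the indicator term pays
    rw [indicator_of_notMem hb, zero_add]
    refine ENNReal.ofReal_le_ofReal ?_
    have hex : ∃ μ : Fin 2, 1 - plSq (y μ) / (r ^ 4 * β) ≤ (y μ 2) ^ 2 := by
      by_contra hcon
      push Not at hcon
      exact hb fun μ => by linarith [hcon μ]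
    obtain ⟨μ₀, hμ₀⟩ := hex
    have hsum : (1 : ℝ) ≤ ∑ μ : Fin 2, (if 1 - plSq (y μ) / (r ^ 4 * β) ≤ (y μ 2) ^ 2 then (1 : ℝ) else 0) := by
      calc (1 : ℝ) = (if 1 - plSq (y μ₀) / (r ^ 4 * β) ≤ (y μ₀ 2) ^ 2 then (1 : ℝ) else 0) := by rw [if_pos hμ₀]
        _ ≤ ∑ μ : Fin 2, (if 1 - plSq (y μ) / (r ^ 4 * β) ≤ (y μ 2) ^ 2 then (1 : ℝ) else 0) :=
          Finset.single_le_sum (f := fun μ => (if 1 - plSq (y μ) / (r ^ 4 * β) ≤ (y μ 2) ^ 2 then (1 : ℝ) else 0))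
            (fun μ _ => by split_ifs <;> norm_num) (Finset.mem_univ μ₀)
    unfold dgapR
    have hA : 0 ≤ (plSq (y 0) * plSq (y 1) / r ^ 4 + (plSq (y 0) + plSq (y 1)) / (2 * r ^ 2)) / β := by positivity
    calc kupR r y ≤ Real.exp (-(plSq (y 0) + plSq (y 1))) := hkup_le
      _ = Real.exp (-(plSq (y 0) + plSq (y 1))) * 1 := (mul_one _).symm
      _ ≤ _ := by gcongr; linarith

end Summit.QuantumFields.YangMills.Theorems.ToronValleyVolume.ZeroMode

end
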